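import Summits.NavierStokesRegularity.NavierStokesRegularity.Theorems.SheetLawsOddContrastSmoothEquation
import Summits.NavierStokesRegularity.NavierStokesRegularity.Theorems.SheetLawsWeakMaxPrinciple
import HarnessLib

/-!
# SHEET LAWS (ROUND-21 of nsreg-p2), engine step (4): the sub-solution inequality for the damped
# odd contrast at a positive local maximum against the barrier `M + c (1 + |x|²)`

Prover seat nsreg-p4 (gen 14), seed s21-3 of nsreg-p2 (gen 23); line material of the route
`SwirlThreshold` (`--supports stmt-NavierStokesRegularity-2002`); theorems only.

* `localMax_barrier_conditions` — first- and second-order conditions at a local maximum of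
  `y ↦ a g(y) − (M + c(1 + |y|²))`, `g ∈ C²`: `a Dg(x) v = 2c⟪x, v⟫`, `a Δg(x) ≤ 6c`,
  `a ∂₂∂₂g(x) ≤ 2c` (`IsLocalMax.fderiv_eq_zero`, the tree's `IsLocalMax.laplacian_nonpos`,
  `IsLocalMax.fderiv_fderiv_apply_nonpos` along the vertical line).
* `dampedContrast_subsolution` — THE POINTWISE STEP of the comparison proof of S-21.1: for a classical
  solution (`ν ≥ 0`) in the axisymmetric odd-swirl class, at a point `x` off the axis where
  `y ↦ a χ̃(τ, y) − (M + c(1 + |y|²))` (`χ̃ = zQuot Γ`, `a` a constant, `M ≥ 0`, `c > 0`) is positive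
  and locally maximal, with `|u(τ, x)| ≤ V` and a compression majorant `-u_z/z ≤ kτ` off the sheet:
  `−kτ · aχ̃ + a ∂ₜχ̃ ≤ (10ν + V) c (1 + |x|²)`.  From `smoothContrast_equation` (sheet points
  included): drift `−2c⟪x,u⟫ ≤ 2cV|x| ≤ Vc(1+|x|²)`, `νaΔχ̃ ≤ 6νc`, `−(2ν/r)·2c⟪x,e_r⟫ ≤ 0`,
  `2νaQ = 4νc` off the sheet (`zQ = ∂₂χ̃`, `a∂₂χ̃ = 2cz`) and `≤ 4νc` on it (`Q = ∂₂∂₂χ̃`), and the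
  potential `−(c̃ + kτ)·aχ̃ ≤ 0` since `aχ̃ > M + c(1+|x|²) ≥ 0` and `c̃ + kτ ≥ 0`
  (`zQuot_apply_two_add_nonneg`).

WHAT THIS IS NOT: a pointwise differential inequality for classical solutions; no regularity claim.
-/

namespace Summit.NavierStokesRegularity.NavierStokesRegularity.Theorems.SheetLaws

open MeasureTheory Set Filter Topology Metric WithLp Function InnerProductSpace
open scoped ContDiff RealInnerProductSpace Laplacian
open Literature.Analysis Literature.Analysis.FluidPDE

noncomputable section

/-- `⟪x, e₂⟫ = x₂`. -/
theorem inner_single_two (x : EuclideanSpace ℝ (Fin 3)) :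
    ⟪x, EuclideanSpace.single (2 : Fin 3) (1 : ℝ)⟫ = x 2 := by
  simp [EuclideanSpace.inner_single_right]

/-- **First- and second-order conditions at a local maximum against the barrier.**  If
`y ↦ a g(y) − (M + c(1 + |y|²))` (`g ∈ C²`) has a local maximum at `x`, then
`a Dg(x) v = 2c ⟪x, v⟫` for all `v`, `a Δg(x) ≤ 6c` and `a ∂₂∂₂g(x) ≤ 2c`. -/
theorem localMax_barrier_conditions {g : EuclideanSpace ℝ (Fin 3) → ℝ} (hg : ContDiff ℝ 2 g)
    {a M c : ℝ} {x : EuclideanSpace ℝ (Fin 3)}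
    (hloc : IsLocalMax (fun y => a * g y - (M + c * (1 + ‖y‖ ^ 2))) x) :
    (∀ v : EuclideanSpace ℝ (Fin 3), a * fderiv ℝ g x v = c * (2 * ⟪x, v⟫)) ∧
      a * (Δ g) x ≤ 6 * c ∧
      a * fderiv ℝ (fun y => fderiv ℝ g y (EuclideanSpace.single 2 1)) x
        (EuclideanSpace.single 2 1) ≤ 2 * c := by
  have hb2 : ContDiff ℝ 2 fun y : EuclideanSpace ℝ (Fin 3) => M + c * (1 + ‖y‖ ^ 2) :=
    contDiff_barrier M c
  have hgd : DifferentiableAt ℝ g x := (hg.differentiable (by norm_num)) x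
  have hW2 : ContDiff ℝ 2 fun y => a * g y - (M + c * (1 + ‖y‖ ^ 2)) :=
    (contDiff_const.mul hg).sub hb2
  refine ⟨fun v => ?_, ?_, ?_⟩
  · -- gradient
    have h1 : fderiv ℝ (fun y => a * g y - (M + c * (1 + ‖y‖ ^ 2))) x = a • fderiv ℝ g x -
        fderiv ℝ (fun y : EuclideanSpace ℝ (Fin 3) => M + c * (1 + ‖y‖ ^ 2)) x :=
      fderiv_const_mul_sub hgd (hb2.differentiable (by norm_num) x) a
    rw [hloc.fderiv_eq_zero] at h1
    have h2 : a • fderiv ℝ g x = fderiv ℝ (fun y : EuclideanSpace ℝ (Fin 3) => M + c * (1 + ‖y‖ ^ 2)) x :=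
      (sub_eq_zero.1 h1.symm)
    have h3 : (a • fderiv ℝ g x) v =
        fderiv ℝ (fun y : EuclideanSpace ℝ (Fin 3) => M + c * (1 + ‖y‖ ^ 2)) x v := by rw [h2]
    have h4 : (a • fderiv ℝ g x) v = a * fderiv ℝ g x v := rfl
    rw [h4, fderiv_barrier_apply] at h3
    exact h3
  · -- Laplacian
    have hlap := Literature.Analysis.FluidPDE.IsLocalMax.laplacian_nonpos hW2 hloc
    rw [laplacian_const_mul_sub hg hb2, laplacian_barrier] at hlap
    linarith
  · -- vertical line
    have h1 := IsLocalMax.fderiv_fderiv_apply_nonpos hW2 hloc (EuclideanSpace.single 2 1)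
    rw [fderiv_fderiv_const_mul_sub_apply hg hb2, fderiv_fderiv_barrier_single_two] at h1
    linarith

variable {s t ν : ℝ} {u : ℝ → EuclideanSpace ℝ (Fin 3) → EuclideanSpace ℝ (Fin 3)}
  {p : ℝ → EuclideanSpace ℝ (Fin 3) → ℝ}

/-- **The sub-solution inequality for the damped odd contrast** (pointwise step of the comparison
proof of S-21.1; see the module docstring): at a point off the axis where
`y ↦ a χ̃(τ, y) − (M + c(1 + |y|²))` is positive and locally maximal,
`−kτ · a χ̃(τ, x) + a ∂ₜχ̃(τ, x) ≤ (10ν + V) c (1 + |x|²)`. -/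
theorem dampedContrast_subsolution (hν : 0 ≤ ν) (hst : s < t)
    (hcl : IsClassicalNSSolutionOn (Icc s t) ν 0 u p)
    (hodd : ∀ τ ∈ Icc s t, IsAxisymmetric (u τ) ∧ IsOddSwirlClass (u τ))
    {τ : ℝ} (hτ : τ ∈ Icc s t) {x : EuclideanSpace ℝ (Fin 3)} (hr : cylRadius x ≠ 0)
    {V M c a kτ : ℝ} (hVx : ‖u τ x‖ ≤ V) (hc0 : 0 < c) (hM : 0 ≤ M)
    (hk : ∀ y : EuclideanSpace ℝ (Fin 3), y 2 ≠ 0 → sheetCompression (u τ) y ≤ kτ)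
    (hpos : 0 < a * zQuot (swirl (u τ)) x - (M + c * (1 + ‖x‖ ^ 2)))
    (hloc : IsLocalMax (fun y => a * zQuot (swirl (u τ)) y - (M + c * (1 + ‖y‖ ^ 2))) x) :
    -kτ * (a * zQuot (swirl (u τ)) x)
      + a * timeDerivWithin (Icc s t) (fun r => zQuot (swirl (u r))) τ x
      ≤ (10 * ν + V) * (c * (1 + ‖x‖ ^ 2)) := by
  have hr0 : 0 < cylRadius x := lt_of_le_of_ne (cylRadius_nonneg x) (Ne.symm hr)
  have hvs : ContDiff ℝ ∞ (u τ) := hcl.contDiff_velocity hτ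
  have hg2 : ContDiff ℝ 2 (zQuot (swirl (u τ))) := (contDiff_smoothContrast hcl hτ)
  obtain ⟨hDapply, hΔ, hzz⟩ := localMax_barrier_conditions hg2 hloc
  -- the equation at `(τ, x)`, multiplied by `a`
  have heq := smoothContrast_equation hst hcl hodd hτ hr (ν := ν)
  have hagt : a * timeDerivWithin (Icc s t) (fun r => zQuot (swirl (u r))) τ x =
      -(a * fderiv ℝ (zQuot (swirl (u τ))) x (u τ x))
      - zQuot (fun y => u τ y 2) x * (a * zQuot (swirl (u τ)) x)
      + ν * (a * (Δ (zQuot (swirl (u τ)))) x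
        - 2 / cylRadius x * (a * fderiv ℝ (zQuot (swirl (u τ))) x (eR x))
        + 2 * (a * zQuot (fun y => fderiv ℝ (zQuot (swirl (u τ))) y
            (EuclideanSpace.single 2 1)) x)) := by
    have h1 := eq_sub_of_add_eq (eq_sub_of_add_eq heq)
    rw [h1]; ring
  -- the pieces
  have hconv : -(c * (2 * ⟪x, u τ x⟫)) ≤ V * (c * (1 + ‖x‖ ^ 2)) := by
    have h1 : |⟪x, u τ x⟫| ≤ ‖x‖ * ‖u τ x‖ := abs_real_inner_le_norm _ _
    have h2 : ‖x‖ * ‖u τ x‖ ≤ ‖x‖ * V := mul_le_mul_of_nonneg_left hVx (norm_nonneg _)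
    have h3 := (abs_le.1 (h1.trans h2)).1
    have h4 : 2 * (‖x‖ * V) ≤ V * (1 + ‖x‖ ^ 2) := by
      nlinarith [sq_nonneg (‖x‖ - 1), norm_nonneg x, (norm_nonneg (u τ x)).trans hVx]
    nlinarith
  have hrad : 0 ≤ ν * (2 / cylRadius x * (c * (2 * ⟪x, eR x⟫))) := by
    have := inner_self_eR_nonneg x
    positivity
  have hQ : ν * (2 * (a * zQuot (fun y => fderiv ℝ (zQuot (swirl (u τ))) y
      (EuclideanSpace.single 2 1)) x)) ≤ 4 * ν * c := by
    by_cases hz : x 2 = 0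
    · -- on the sheet `Q = ∂₂∂₂ χ̃`
      rw [zQuot_fderiv_two_of_sheet hcl hτ hz]
      nlinarith [hzz, hν]
    · -- off the sheet `z Q = ∂₂ χ̃` and `a ∂₂χ̃ = 2c z`
      have hv3 : ContDiff ℝ 3 (u τ) := hvs.of_le (by norm_cast)
      have hm := mul_zQuot_fderiv_two hv3 (hodd τ hτ).1 (hodd τ hτ).2 x
      have h2 := hDapply (EuclideanSpace.single 2 1)
      rw [inner_single_two] at h2
      have h4 : x 2 * (a * zQuot (fun y => fderiv ℝ (zQuot (swirl (u τ))) y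
          (EuclideanSpace.single 2 1)) x) = x 2 * (2 * c) := by
        calc x 2 * (a * zQuot (fun y => fderiv ℝ (zQuot (swirl (u τ))) y
              (EuclideanSpace.single 2 1)) x)
            = a * (x 2 * zQuot (fun y => fderiv ℝ (zQuot (swirl (u τ))) y
              (EuclideanSpace.single 2 1)) x) := by ring
          _ = a * fderiv ℝ (zQuot (swirl (u τ))) x (EuclideanSpace.single 2 1) := by rw [hm]
          _ = x 2 * (2 * c) := by rw [h2]; ring
      have h3 := mul_left_cancel₀ hz h4
      rw [h3]
      linarith
  have hpot : 0 ≤ (zQuot (fun y => u τ y 2) x + kτ) * (a * zQuot (swirl (u τ)) x) := by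
    have h1 : 0 ≤ zQuot (fun y => u τ y 2) x + kτ := zQuot_apply_two_add_nonneg hcl hodd hτ hk x
    have h2 : 0 < a * zQuot (swirl (u τ)) x := by
      have h4 : 0 ≤ c * (1 + ‖x‖ ^ 2) := by positivity
      linarith
    positivity
  have hνΔ : ν * (a * (Δ (zQuot (swirl (u τ)))) x) ≤ ν * (6 * c) := mul_le_mul_of_nonneg_left hΔ hν
  have h10 : ν * (6 * c) + 4 * ν * c ≤ 10 * ν * (c * (1 + ‖x‖ ^ 2)) := by
    have hp : 0 ≤ ν * c * ‖x‖ ^ 2 := by positivity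
    nlinarith
  rw [hagt, hDapply (u τ x), hDapply (eR x)]
  linarith [hνΔ, hQ, hpot, hrad, hconv, h10]

end

end Summit.NavierStokesRegularity.NavierStokesRegularity.Theorems.SheetLaws
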